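import Summits.QuantumFields.YangMills.Theorems.BalabanUVNodesN12DirectChartPackageOfClassL1
import Literature.MathematicalPhysics.QuantumFieldTheory.Balaban1983to89.Node00.MultiScaleFibreChartLocalityComponent

/-!
# DAG node N12 [B15] — THE DIRECT ROAD's CHART ROWS AND CHART HALF WITH THE (μ) ROW KEYED ON PER-ROW ℓ¹ PREIMAGES (uniformity pen ρ6b, census §7 U2b at the consumer): the
# Lagrange multiplier is canonical, so the right inverse's SIZE enters only one constraint row at a time — the letter a non-linear (choice-built) solver can inhabit per height;
# and the (K) row reads a DISPLAYED ℓ² velocity letter, so NO explicit bond count is left in the (K),(μ) rows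

[Balaban1989LargeFieldII] = «[LF-II]», p. 357, (1.12)–(1.13) p. 359; [Balaban1985Variational] = «[15]», (2) p. 278, Sect. C (44)–(48) p. 285, (81)–(83) p. 290, (170)–(171) p. 305;
[Balaban1988Convergent] = «[III]», (2.2) p. 255, (2.10)–(2.13) pp. 256–257.

Cell `pub-ymgap`, HUMAN RULINGS D-0062 ∕ D-0149, lane owner `pub-ymgap-dag-n12-c` (g22).  Key K1⁹ `stmt-QuantumFields-27364`, `--kind proof --supports … --as helper`; count-neutral.
NEW leaf; CONSUMED BY NAME, nothing modified: this lane's ρ6 `N12DirectChartPackageOfClassL1` (p683432: statements copied with ONE letter changed), ρ5b `N12TowerProxiesOfClass`, dag-n12-w4's `Node00.fderiv_msChart_apply_levelZero` ∕ `fderiv_fderiv_msChart_apply_levelZero` (`Node00/MultiScaleFibreChartLocalityComponent`: the Γ₀ layer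
of the linearised chart is EXACT).

WHY.  ρ6 displays the right inverse `H` through an ℓ¹ → ℓ¹ letter `Σ_b ‖(H v)_b‖ ≤ B₁·Σ_c ‖v_c‖` for ALL data `v`.  For a LINEAR `H` with tower-local columns that letter is per height; but
the right inverse of record (dag-n12-w6, p664681 ∕ p678596 ∕ the graded-support edition) is built by `choose`, rank by rank — not linear — and its graded support hull is per height
ONLY FOR ONE-ROW data.  The (μ) row never needs more: the multiplier `λ` is the UNIQUE functional with `D(A∘expChart U₀)(0) = λ ∘ DΨ(0)` (surjectivity), hence LINEAR and independent
of the solver, so `|λ v| ≤ Σ_i |λ(e_i v_i)|` and each one-row term is `D(A∘expChart U₀)(0) x_i` for ANY preimage `x_i` of `e_i v_i` — bounded by the plaquette-small current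
`2(d−1)·ε_P·Σ_b ‖(x_i)_b‖` as soon as `x_i` vanishes off `Ω₁(Z)`, which it does for every preimage of a positive-level one-row datum (exact Γ₀ layer: `(DΨ(0) x)(idx b) = x_b`).
THIS FILE therefore displays, instead of any size letter on `H`, the PER-ROW ℓ¹ PREIMAGE LETTER
`hrow : ∀ i of level ≥ 1, ∀ ξ, ∃ x, DΨ(0) x = e_i ξ ∧ Σ_b ‖↑x_b‖_op ≤ B₁‖ξ‖`, keeps `(H, hHinv)` only as a witness of surjectivity, keeps ρ6's ℓ¹-curvature letter `hM₂1`, and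
concludes the same (μ) constant `2(d−1)·ε_P·B₁·M₂`.  Likewise the (K) row: ρ5c∕ρ6 DERIVE `p(X_f′X) ≤ (12𝓐₀/R)·√#{b | b.src ∈ Ω₁(Z)}·‖X‖` from (J0′)'s per-bond Cauchy bound × the
support letter; THIS FILE displays instead the ℓ² VELOCITY LETTER `hK2 : ∀ X, √(Σ_b ‖(X_f′X)_b‖²) ≤ K₂‖X‖` (today's inhabitant `K₂ := (12𝓐₀/R)·√#{b | b.src ∈ Ω₁(Z)}` by
`N12NearFlatChartLetter.l2Seminorm_le_of_bound_of_support`, sequel `hK2_of_bound_of_support`; print's inhabitant = the decay of the chart velocity, memo `N12-UNIFORMITY-SPEC.md` §3 U2a)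
and the binders `R 𝓐₀` leave the chart half.  Inhabitants of `hrow`: ρ6's ℓ¹ → ℓ¹ letter gives `hrow` at the same `B₁` (sequel `…RowL1Family.hrow_of_hHB1`); a choice-built solver
with a per-height support hull `h` for one-row data and a sup bound `B` gives `B₁ = h·B` (sequel `hrow_of_support_sup`).

CONTENTS (namespace `Summit.QuantumFields.YangMills.BalabanUVNodes.N12DirectChartPackageOfClassRowL1`; theorems only — no `def`, no `instance`, no `sorry`).
* §1 ★★★ `chartRows_direct_of_class_rowl1` — ρ6 §1 VERBATIM except: `hHB1` ↦ `hrow` (per-row ℓ¹ preimage letter for the positive-level rows), `(hKb, hsupp, R, 𝓐₀)` ↦ `hK2` (ℓ²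
  velocity letter) with the (K) row `p(X_f′X) ≤ K₂‖X‖`; the multiplier bound is proved row by row through the linearity of `λ` and the exact Γ₀ layer.
* §2 ★★★ `exists_hWD_chartHalf_of_class_uniform_rowl1` — ρ6 §2 VERBATIM with the same letter changes in the ∀-body (the chart-half letter a consumer displays as `hhalf`; the Federbush
  term reads `C·δ_W·K₂`).

HONEST FRAMING ∕ LOCATED.  Composition by name + linear algebra of the multiplier; `(H, hHinv)`, `hrow` ((P4)′ in per-row ℓ¹ currency) and `hM₂1` ((P5) in ℓ¹ currency) stay
DISPLAYED, and `hK2` ((K) in ℓ² letter currency — its inhabitant of record still carries `√#{b | b.src ∈ Ω₁(Z)}`; a decay inhabitant, census U2a, is NOT claimed); per-height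
∃-constants as before; a per-height `B₁` still needs the solver's sup bound
`B` to be per height (dag-n12-w6's LOCATED-B) — NOT claimed; nothing of Bałaban's (1.7) ∕ (1.12) ∕ Prop. 1 asserted; count-neutral helper; N12 NOT discharged; K1⁹ NOT closed;
counts unmoved; one finite 𝕋⁴ programme at fixed ε — R4 closes the conditional finite-𝕋⁴ rung `BalabanLadder.UV` only; NOT continuum ∕ OS ∕ mass gap ∕ Clay.
-/

noncomputable section
open scoped BigOperators Matrix.Norms.L2Operator Topology
open Filter Finset

namespace Summit.QuantumFields.YangMills.BalabanUVNodes.N12DirectChartPackageOfClassRowL1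

open Literature.MathematicalPhysics.QuantumFieldTheory.Balaban1983to89
open Literature.MathematicalPhysics.QuantumLattice (quatMatrix)
open T4Continuum (T4Family)
open T4HaarSU2ExpChart (imQuat)
open T4AdjointCovarianceUnitary (lieSU)
open T4CubeChartGnomonic (SU2)
open B15DeterminingSets GaugeField
open B14.Eq213DetSet (Bj Bj_of_gt maxDomT)
open B14.Eq216Concrete (feeds)
open B15Prop1SliceCoordinates (GaugeSlice ιA)
open B15Prop1ChartCalculusSU2 (E3)
open B15Prop1ChartSU2 (su2Chart)
open B16Sect1Backgrounds (expMul)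
open T4AxialGaugeSmallField (castSite)
open B6TreeGaugePoincare (curl)
open B16Eq18Proof (box)
open LatticeFieldCalculus (runSite)
open BlockAveragingEMLLinearised (linAvg)
open Literature.MathematicalPhysics.QuantumFieldTheory.BalabanImbrieJaffe1984to88.BIJ85Eq453GaugeField (qsstarGIter0)
open Node00
open B16Ineq19FlatSliceChart (exists_lieSU2Coord)
open Summit.QuantumFields.YangMills.BalabanUVNodes.N12NearFlatChartLetter (sum_opNorm_sq_le_l2Seminorm_sq l2Seminorm_le_of_bound_of_support
  l2Seminorm_le_sqrt_card_mul_norm sum_opNorm_le_sqrt_card_mul_l2Seminorm l2Seminorm_apply l2Seminorm_sq)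
open Summit.QuantumFields.YangMills.BalabanUVNodes.N12RightInverseLevelZeroLocality (mem_bondsOf_Bj_zero)
open B16Ineq17NearFlatWilsonLetters (fderiv_wilsonAction4_expChart_apply_eq_deriv)
open Summit.QuantumFields.YangMills.BalabanUVNodes.N12NearFlatFederbushFibreRecord (hcons_of_plaqsInside_maxDomT)
open Summit.QuantumFields.YangMills.BalabanUVNodes.N12NearFlatFederbushFibreWindowKnit (runSite_runSite_blockSite_mem_tower)
open Summit.QuantumFields.YangMills.BalabanUVNodes.N12NearFlatFederbushVelocityWindow (exists_hmX_federbush_window_of_isMinimizer_family)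
open Summit.QuantumFields.YangMills.BalabanUVNodes.N12DirectChartLetterCore (exists_twistSize_of_nearFlat_feeds abs_fderiv_wilsonAction4_expChart_apply_le_of_plaqSmall norm_le_sqrt_sum_sq)
open Summit.QuantumFields.YangMills.BalabanUVNodes.N12DirectChartLetterHSupportVacuity (hHsupp_levelZeroFree_of_rightInverse fderiv_fderiv_msChart_levelZeroFree_direct)
open Summit.QuantumFields.YangMills.BalabanUVNodes.N12NearFlatFederbushVelocityWindow (hmX_federbush_window_of_delta2Component)
open Summit.QuantumFields.YangMills.BalabanUVNodes.N12NearFlatDelta2LetterComponent (exists_delta2_letter_component)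
open Summit.QuantumFields.YangMills.BalabanUVNodes.N12DirectChartLetterHSupportVacuity (rightInverse_apply_levelZero)
open Summit.QuantumFields.YangMills.BalabanUVNodes.N12TowerProxiesOfClass (chartLetters_msChart_Bj_of_isMinimizer_of_class exists_lam_msChart_Bj_of_isMinimizer_regMSCoPOfRecord_of_class)
open B14.Eq213MaximalDomains (side)
open B16Ineq19NearFlatSliceNorms (opNorm_coe_le_norm_lieSU)

variable {F : T4Family}

/-! ## §1  The chart rows from the class, (μ) keyed on per-row ℓ¹ preimages -/

section Core

/-- ★★★ **THE DIRECT CHART ROWS, (μ) KEYED ON PER-ROW ℓ¹ PREIMAGES** — ρ6's `N12DirectChartPackageOfClassL1.chartRows_direct_of_class_l1` VERBATIM except: the right inverse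
`(H, hHinv)` carries NO size letter (it only witnesses surjectivity of `DΨ(0)`, hence the multiplier), and the (μ) row reads the PER-ROW ℓ¹ PREIMAGE LETTER
`hrow : ∀ i, 1 ≤ level i → ∀ ξ, ∃ x, DΨ(0) x = e_i ξ ∧ Σ_b ‖↑x_b‖_op ≤ B₁‖ξ‖`, and the (K) row reads the ℓ² velocity letter `hK2 : √(Σ_b ‖(X_f′X)_b‖²) ≤ K₂‖X‖` (so `(K)` is
`p(X_f′X) ≤ K₂‖X‖` and `R, 𝓐₀, hKb, hsupp` are gone); (μ) constant `2(d−1)·ε_P·B₁·M₂`.  Proof: `λ` is linear, `v = Σ_i e_i v_i`; a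
level-0 row of `v = D²Ψ(0)(Y,Y)` vanishes (exact Γ₀ layer, dag-n12-w4); a positive-level one-row term is `D(A∘expChart U₀)(0) x_i` for the letter's preimage `x_i`, which vanishes off
`Ω₁(Z)` (`(DΨ(0) x_i)(idx b) = (x_i)_b` at every level-0 row), so the plaquette-small current bounds it by `2(d−1)·ε_P·B₁‖v_i‖`.
[cite: Balaban1989LargeFieldII, p.357, (1.12)–(1.13) p.359; Balaban1985Variational, Sect. C (44)–(48) p.285, (81)–(83) p.290, (170)–(171) p.305; Balaban1988Convergent, (2.2) p.255, (2.11)–(2.13) pp.256–257] -/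
theorem chartRows_direct_of_class_rowl1 (ν : Node00.Stage7Numerics) (Kt : ℕ) {k : ℕ} (hk0 : 0 < k)
    (Z Λ : Set (Site (F.P Kt) 0)) (T : Finset (PBond (F.P Kt) k))
    (ext : GaugeField (F.P Kt) k SU2 → GaugeField (F.P Kt) k SU2) (Vk : GaugeField (F.P Kt) k SU2)
    (U₀ : GaugeField (F.P Kt) 0 SU2) (Xf : GaugeSlice (pts k Λ) T E3 → PBond (F.P Kt) 0 → lieSU (Fin 2))
    (hmin0 : IsMinimizer (Node00.avOfRecord F 2 Kt) (Node00.regMSCoPOfRecord F 2 ν Kt k (maxDomT ν.M₁ Z)) (Bj ν.M₁ Z k)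
      (avgFamily (Node00.avOfRecord F 2 Kt) (qsstarGIter0 k (ext Vk))) U₀)
    -- LOCATED-HSB: NO global small-below guard at `U₀` — the chart letters are read off the minimiser's own (2.12) class through per-bond proxies (`N12TowerProxiesOfClass`);
    -- its rows: the height fits, `4L ≤ M₁`, the cube divisibility, `0 ≤ εreg`, the per-height radius letter `hsbU` and ONE volume-free floor on `εreg`
    (hkK : k + 1 ≤ (F.P Kt).m + (F.P Kt).K) (hM4 : 4 * (F.P Kt).L ≤ ν.M₁) (hdiv : side (F.P Kt).L ν.M₁ k ∣ (F.P Kt).sitesPerDir 0) (hε : 0 ≤ ν.εreg)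
    {ρ'' : ℝ} (hsbU : ∀ V : GaugeField (F.P Kt) 0 SU2, ‖coeField V - 1‖ ≤ ρ'' → SmallBelow (Node00.avOfRecord F 2 Kt) k V)
    (hερ : 6 * ((((F.P Kt).d - 1 : ℕ)) : ℝ) * (F.P Kt).L * ν.εreg ≤ ρ'')
    -- P1: plaquette smallness where the first variation is read (displayed, gauge-invariant)
    {εP : ℝ} (hεP0 : 0 ≤ εP)
    (hP : ∀ p : Plaq (F.P Kt) 0, ((⟨p.src, p.μ⟩ : PBond (F.P Kt) 0) ∈ {b : PBond (F.P Kt) 0 | b.src ∈ maxDomT ν.M₁ Z 1} ∨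
          (⟨p.src.shift p.μ, p.ν⟩ : PBond (F.P Kt) 0) ∈ {b : PBond (F.P Kt) 0 | b.src ∈ maxDomT ν.M₁ Z 1} ∨
          (⟨p.src.shift p.ν, p.μ⟩ : PBond (F.P Kt) 0) ∈ {b : PBond (F.P Kt) 0 | b.src ∈ maxDomT ν.M₁ Z 1} ∨
          (⟨p.src, p.ν⟩ : PBond (F.P Kt) 0) ∈ {b : PBond (F.P Kt) 0 | b.src ∈ maxDomT ν.M₁ Z 1}) →
      ‖((GaugeField.plaqHol U₀ p : SU2) : Matrix (Fin 2) (Fin 2) ℂ) - 1‖ ≤ εP)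
    -- hH: a right inverse ((P4)′ socket) as a WITNESS OF SURJECTIVITY only — no size letter on `H`
    (H : (Fin (constrCard (Bj ν.M₁ Z k) k) → lieSU (Fin 2)) → PBond (F.P Kt) 0 → lieSU (Fin 2))
    (hHinv : ∀ v, fderiv ℝ (msChart F 2 Kt k (Bj ν.M₁ Z k) (avgFamily (avOfRecord F 2 Kt) (qsstarGIter0 k (ext Vk))) U₀) 0 (H v) = v)
    -- hrow: the PER-ROW ℓ¹ PREIMAGE LETTER for the positive-level rows (ρ6b: the right inverse's size enters one constraint row at a time)
    {B₁ : ℝ} (hB1 : 0 ≤ B₁)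
    (hrow : ∀ i : Fin (constrCard (Bj ν.M₁ Z k) k), 1 ≤ ((((constrEnum (Bj ν.M₁ Z k) k).symm i).1 : ℕ)) → ∀ ξ : lieSU (Fin 2),
      ∃ x : PBond (F.P Kt) 0 → lieSU (Fin 2), fderiv ℝ (msChart F 2 Kt k (Bj ν.M₁ Z k) (avgFamily (avOfRecord F 2 Kt) (qsstarGIter0 k (ext Vk))) U₀) 0 x = Pi.single i ξ ∧
        ∑ b, ‖(x b : Matrix (Fin 2) (Fin 2) ℂ)‖ ≤ B₁ * ‖ξ‖)
    -- hM₂: the chart curvature at `U₀` in ℓ¹ CURRENCY (displayed): the constraint-ℓ¹ size of `D²Ψ(0)(w,w)` against the bond-ℓ² size of `w` (ρ6: no explicit constraint count in (μ))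
    {M₂ : ℝ}
    (hM₂1 : ∀ w, ∑ c, ‖fderiv ℝ (fderiv ℝ (msChart F 2 Kt k (Bj ν.M₁ Z k) (avgFamily (avOfRecord F 2 Kt) (qsstarGIter0 k (ext Vk))) U₀)) 0 w w c‖ ≤ M₂ * ∑ b, ‖w b‖ ^ 2)
    -- the (K) LETTER (ρ6b: the chart velocity's bond-ℓ² size DISPLAYED, not derived from a per-bond bound × support — no explicit bond count in (K))
    {K₂ : ℝ}
    (hK2 : ∀ X : GaugeSlice (pts k Λ) T E3, Real.sqrt (∑ b, ‖fderiv ℝ Xf 0 X b‖ ^ 2) ≤ K₂ * ‖X‖) :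
    ∃ (Ψ₂ : (PBond (F.P Kt) 0 → lieSU (Fin 2)) →L[ℝ] (PBond (F.P Kt) 0 → lieSU (Fin 2)) →L[ℝ] (Fin (constrCard (Bj ν.M₁ Z k) k) → lieSU (Fin 2)))
      (lam : (Fin (constrCard (Bj ν.M₁ Z k) k) → lieSU (Fin 2)) →L[ℝ] ℝ)
      (p : Seminorm ℝ (PBond (F.P Kt) 0 → lieSU (Fin 2))),
      HasFDerivAt (fun Y => fderiv ℝ (msChart F 2 Kt k (Bj ν.M₁ Z k) (avgFamily (avOfRecord F 2 Kt) (qsstarGIter0 k (ext Vk))) U₀) Y) Ψ₂ 0 ∧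
      (∀ᶠ Y in 𝓝 (0 : PBond (F.P Kt) 0 → lieSU (Fin 2)), DifferentiableAt ℝ (msChart F 2 Kt k (Bj ν.M₁ Z k) (avgFamily (avOfRecord F 2 Kt) (qsstarGIter0 k (ext Vk))) U₀) Y) ∧
      fderiv ℝ (fun Y : PBond (F.P Kt) 0 → lieSU (Fin 2) => wilsonAction4 (expChart U₀ Y)) 0 = lam.comp (fderiv ℝ (msChart F 2 Kt k (Bj ν.M₁ Z k) (avgFamily (avOfRecord F 2 Kt) (qsstarGIter0 k (ext Vk))) U₀) 0) ∧
      (∀ Y : PBond (F.P Kt) 0 → lieSU (Fin 2), ∑ b, ‖(Y b : Matrix (Fin 2) (Fin 2) ℂ)‖ ^ 2 ≤ p Y ^ 2) ∧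
      ∀ X : GaugeSlice (pts k Λ) T E3,
        lam (Ψ₂ (fderiv ℝ Xf 0 X) (fderiv ℝ Xf 0 X))
            ≤ (2 * (((F.P Kt).d : ℝ) - 1) * εP * B₁ * M₂) * p (fderiv ℝ Xf 0 X) ^ 2 ∧
        p (fderiv ℝ Xf 0 X) ≤ K₂ * ‖X‖ := by
  classical
  -- ### the junction's seminorm `p := bond-ℓ²(HS)` and its letters (as in (χ)_N)
  let p : Seminorm ℝ (PBond (F.P Kt) 0 → lieSU (Fin 2)) :=
    (normSeminorm ℝ (PiLp 2 (fun _ : PBond (F.P Kt) 0 => lieSU (Fin 2)))).comp (WithLp.linearEquiv 2 ℝ (PBond (F.P Kt) 0 → lieSU (Fin 2))).symm.toLinearMap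
  have hp : ∀ Y : PBond (F.P Kt) 0 → lieSU (Fin 2), ∑ b, ‖(Y b : Matrix (Fin 2) (Fin 2) ℂ)‖ ^ 2 ≤ p Y ^ 2 := fun Y => sum_opNorm_sq_le_l2Seminorm_sq Y
  have hpsq : ∀ Y : PBond (F.P Kt) 0 → lieSU (Fin 2), p Y ^ 2 = ∑ b, ‖Y b‖ ^ 2 := fun Y => l2Seminorm_sq Y
  have hpY : ∀ Y : PBond (F.P Kt) 0 → lieSU (Fin 2), p Y = Real.sqrt (∑ b, ‖Y b‖ ^ 2) := fun Y => l2Seminorm_apply Y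
  -- ### fibre, regularity, multiplier
  have hUfib : AgreeOn (Bj ν.M₁ Z k) (avgFamily (avOfRecord F 2 Kt) U₀) (avgFamily (avOfRecord F 2 Kt) (qsstarGIter0 k (ext Vk))) := hmin0.2.1
  obtain ⟨-, hstrict, ⟨hΨ₂, hΨd⟩, -⟩ := chartLetters_msChart_Bj_of_isMinimizer_of_class ν Kt Z hkK hM4 hdiv hε hsbU hερ hmin0
  have hΨ : DifferentiableAt ℝ (msChart F 2 Kt k (Bj ν.M₁ Z k) (avgFamily (avOfRecord F 2 Kt) (qsstarGIter0 k (ext Vk))) U₀) 0 := hstrict.hasFDerivAt.differentiableAt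
  have hsurj : Function.Surjective (fderiv ℝ (msChart F 2 Kt k (Bj ν.M₁ Z k) (avgFamily (avOfRecord F 2 Kt) (qsstarGIter0 k (ext Vk))) U₀) 0) := fun v => ⟨H v, hHinv v⟩
  obtain ⟨lam, hlam⟩ := exists_lam_msChart_Bj_of_isMinimizer_regMSCoPOfRecord_of_class ν Kt Z hkK hM4 hdiv hε hsbU hερ hmin0 hsurj
  -- ### the multiplier bound from the PLAQUETTE-SMALL current factor on the range of `H`
  have hd1 : 0 ≤ ((F.P Kt).d : ℝ) - 1 := by
    have h1 : (1 : ℝ) ≤ (F.P Kt).d := by exact_mod_cast (F.P Kt).hd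
    linarith
  have hlamv : ∀ v : Fin (constrCard (Bj ν.M₁ Z k) k) → lieSU (Fin 2),
      (∀ (c : PBond (F.P Kt) 0) (hc : c ∈ bondsOf ((Bj ν.M₁ Z k : DetSet (F.P Kt)) 0)),
        v (constrEnum (Bj ν.M₁ Z k : DetSet (F.P Kt)) k ⟨⟨0, Nat.succ_pos k⟩, c, hc⟩) = 0) →
      |lam v| ≤ (2 * (((F.P Kt).d : ℝ) - 1) * εP * B₁) * ∑ i, ‖v i‖ := by
    intro v hv
    -- one row at a time: `λ` is linear and `v = Σ_i e_i v_i`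
    have hterm : ∀ i, |lam (Pi.single i (v i))| ≤ (2 * (((F.P Kt).d : ℝ) - 1) * εP * B₁) * ‖v i‖ := by
      intro i
      obtain ⟨⟨⟨j, hj⟩, c, hc⟩, rfl⟩ : ∃ s, i = constrEnum (Bj ν.M₁ Z k : DetSet (F.P Kt)) k s := ⟨_, ((constrEnum (Bj ν.M₁ Z k : DetSet (F.P Kt)) k).apply_symm_apply i).symm⟩
      rcases Nat.eq_zero_or_pos j with rfl | hjpos
      · -- a level-0 row: the datum vanishes there
        rw [hv c hc, Pi.single_zero, map_zero, abs_zero]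
        positivity
      · -- a positive-level row: any preimage of the one-row datum vanishes off Ω₁(Z) (exact Γ₀ layer), so the plaquette-small current bounds the term
        have hlev : 1 ≤ ((((constrEnum (Bj ν.M₁ Z k) k).symm (constrEnum (Bj ν.M₁ Z k : DetSet (F.P Kt)) k ⟨⟨j, hj⟩, c, hc⟩)).1 : ℕ)) := by
          rw [Equiv.symm_apply_apply]; exact hjpos
        obtain ⟨x, hx, hxB⟩ := hrow _ hlev (v (constrEnum (Bj ν.M₁ Z k : DetSet (F.P Kt)) k ⟨⟨j, hj⟩, c, hc⟩))
        have hxsupp : ∀ b : PBond (F.P Kt) 0, b.src ∉ maxDomT ν.M₁ Z 1 → x b = 0 := by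
          intro b hb
          have hbm : b ∈ bondsOf ((Bj ν.M₁ Z k : DetSet (F.P Kt)) 0) := (mem_bondsOf_Bj_zero hk0 Z b).2 (Or.inl hb)
          have h1 := fderiv_msChart_apply_levelZero hUfib hΨ b hbm x
          have hne : constrEnum (Bj ν.M₁ Z k : DetSet (F.P Kt)) k ⟨⟨0, Nat.succ_pos k⟩, b, hbm⟩ ≠ constrEnum (Bj ν.M₁ Z k : DetSet (F.P Kt)) k ⟨⟨j, hj⟩, c, hc⟩ := by
            intro h
            have h' := congrArg (fun s : ConstrSet (Bj ν.M₁ Z k : DetSet (F.P Kt)) k => ((s.1 : ℕ))) ((constrEnum (Bj ν.M₁ Z k : DetSet (F.P Kt)) k).injective h)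
            simp only at h'
            omega
          rw [← h1, hx, Pi.single_eq_of_ne hne]
        have h1 : lam (Pi.single (constrEnum (Bj ν.M₁ Z k : DetSet (F.P Kt)) k ⟨⟨j, hj⟩, c, hc⟩) (v (constrEnum (Bj ν.M₁ Z k : DetSet (F.P Kt)) k ⟨⟨j, hj⟩, c, hc⟩)))
            = fderiv ℝ (fun Y : PBond (F.P Kt) 0 → lieSU (Fin 2) => wilsonAction4 (expChart U₀ Y)) 0 x := by
          rw [← hx, hlam, ContinuousLinearMap.comp_apply]
        rw [h1]
        calc |fderiv ℝ (fun Y : PBond (F.P Kt) 0 → lieSU (Fin 2) => wilsonAction4 (expChart U₀ Y)) 0 x|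
            ≤ 2 * (((F.P Kt).d : ℝ) - 1) * εP * ∑ b : PBond (F.P Kt) 0, ‖(x b : Matrix (Fin 2) (Fin 2) ℂ)‖ :=
              abs_fderiv_wilsonAction4_expChart_apply_le_of_plaqSmall ν Z U₀ hP x hxsupp
          _ ≤ 2 * (((F.P Kt).d : ℝ) - 1) * εP * (B₁ * ‖v (constrEnum (Bj ν.M₁ Z k : DetSet (F.P Kt)) k ⟨⟨j, hj⟩, c, hc⟩)‖) := mul_le_mul_of_nonneg_left hxB (by positivity)
          _ = (2 * (((F.P Kt).d : ℝ) - 1) * εP * B₁) * ‖v (constrEnum (Bj ν.M₁ Z k : DetSet (F.P Kt)) k ⟨⟨j, hj⟩, c, hc⟩)‖ := by ring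
    calc |lam v| = |∑ i, lam (Pi.single i (v i))| := by rw [← map_sum, Finset.univ_sum_single]
      _ ≤ ∑ i, |lam (Pi.single i (v i))| := Finset.abs_sum_le_sum_abs _ _
      _ ≤ ∑ i, (2 * (((F.P Kt).d : ℝ) - 1) * εP * B₁) * ‖v i‖ := Finset.sum_le_sum fun i _ => hterm i
      _ = (2 * (((F.P Kt).d : ℝ) - 1) * εP * B₁) * ∑ i, ‖v i‖ := by rw [Finset.mul_sum]
  -- ### assemble
  refine ⟨fderiv ℝ (fderiv ℝ (msChart F 2 Kt k (Bj ν.M₁ Z k) (avgFamily (avOfRecord F 2 Kt) (qsstarGIter0 k (ext Vk))) U₀)) 0, lam, p, hΨ₂, hΨd, hlam, hp, fun X => ⟨?_, ?_⟩⟩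
  · -- (μ): multiplier bound (ℓ¹ on the constraints) × ℓ¹-curvature letter × `Σ_b ‖w_b‖² = p(w)²`
    have hc0 : 0 ≤ 2 * (((F.P Kt).d : ℝ) - 1) * εP * B₁ := by positivity
    calc lam (fderiv ℝ (fderiv ℝ (msChart F 2 Kt k (Bj ν.M₁ Z k) (avgFamily (avOfRecord F 2 Kt) (qsstarGIter0 k (ext Vk))) U₀)) 0 (fderiv ℝ Xf 0 X) (fderiv ℝ Xf 0 X))
        ≤ |lam (fderiv ℝ (fderiv ℝ (msChart F 2 Kt k (Bj ν.M₁ Z k) (avgFamily (avOfRecord F 2 Kt) (qsstarGIter0 k (ext Vk))) U₀)) 0 (fderiv ℝ Xf 0 X) (fderiv ℝ Xf 0 X))| := le_abs_self _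
      _ ≤ (2 * (((F.P Kt).d : ℝ) - 1) * εP * B₁) * ∑ c, ‖fderiv ℝ (fderiv ℝ (msChart F 2 Kt k (Bj ν.M₁ Z k) (avgFamily (avOfRecord F 2 Kt) (qsstarGIter0 k (ext Vk))) U₀)) 0 (fderiv ℝ Xf 0 X) (fderiv ℝ Xf 0 X) c‖ :=
          hlamv _ (fun c hc => fderiv_fderiv_msChart_apply_levelZero hUfib hΨd hΨ₂.differentiableAt c hc _ _)
      _ ≤ (2 * (((F.P Kt).d : ℝ) - 1) * εP * B₁) * (M₂ * ∑ b, ‖fderiv ℝ Xf 0 X b‖ ^ 2) := mul_le_mul_of_nonneg_left (hM₂1 _) hc0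
      _ = (2 * (((F.P Kt).d : ℝ) - 1) * εP * B₁ * M₂) * p (fderiv ℝ Xf 0 X) ^ 2 := by rw [hpsq]; ring
  · -- (K): the displayed ℓ² letter, read through `p(Y) = √(Σ_b ‖Y_b‖²)`
    rw [hpY]
    exact hK2 X

end Core

/-! ## §2  The chart half from the class, constants per height before the instance -/

section Package

/-- ★★★ **THE CHART HALF OF THE (WD) PACKAGE, (μ) KEYED ON PER-ROW ℓ¹ PREIMAGES, CONSTANTS PER HEIGHT BEFORE THE INSTANCE** — ρ6's
`N12DirectChartPackageOfClassL1.exists_hWD_chartHalf_of_class_uniform_l1` VERBATIM except, in the ∀-body: the right inverse carries no size letter and the per-row ℓ¹ preimage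
letter `∀ i, 1 ≤ level i → ∀ ξ, ∃ x, DΨ(0) x = e_i ξ ∧ Σ_b ‖↑x_b‖_op ≤ B₁‖ξ‖` takes the place of `hHB1`, and the ℓ² velocity letter `∀ X, √(Σ_b ‖(X_f′X)_b‖²) ≤ K₂‖X‖` the place of
`(R, 𝓐₀, hKb, hsupp)` (every `(12𝓐₀/R)·√#{…}` of ρ6 reads `K₂`).  This ∀-body IS the chart-half letter `hhalf` a consumer displays; its
family form is `N12DirectChartPackageOfClassRowL1Family.exists_hWD_chartHalf_of_class_uniform_rowl1_family`.  Proof: ρ6 §2's over §1.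
[cite: Balaban1989LargeFieldII, p.357, (1.7) p.358, (1.12)–(1.13) p.359; Balaban1985Variational, (45) p.285, (81)–(83) p.290, (172) p.305; Balaban1988Convergent, (2.2) p.255, (2.10)–(2.13) pp.256–257] -/
theorem exists_hWD_chartHalf_of_class_uniform_rowl1 (Kt : ℕ) (h0 : 0 < (F.P Kt).d) {k : ℕ} (hk0 : 0 < k) (hk : k ≤ (F.P Kt).m + (F.P Kt).K) :
    ∃ C ρ Kτ ρτ ρ'' : ℝ, 0 ≤ C ∧ 0 < ρ ∧ 0 ≤ Kτ ∧ 0 < ρτ ∧ 0 < ρ'' ∧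
      ∀ (ν : Node00.Stage7Numerics) (Z Λ : Set (Site (F.P Kt) 0)) (T : Finset (PBond (F.P Kt) k)) (lo hi : Fin (F.P Kt).d → ℤ),
      (∀ κ, ((((hi κ - lo κ + 1).toNat + 3 : ℕ) : ℤ)) ≤ (F.P Kt).sitesPerDir k) →
      (∀ (ν' : Fin (F.P Kt).d), ∀ z ∈ box (fun κ => (hi κ - lo κ + 1).toNat + 3) (fun κ => lo κ - 2),
        (castSite z : Site (F.P Kt) k) ∈ pts k (maxDomT ν.M₁ Z k) ∧ (castSite z : Site (F.P Kt) k).shift ⟨0, h0⟩ ∈ pts k (maxDomT ν.M₁ Z k) ∧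
          (castSite z : Site (F.P Kt) k).shift ν' ∈ pts k (maxDomT ν.M₁ Z k)) →
      k + 1 ≤ (F.P Kt).m + (F.P Kt).K → 4 * (F.P Kt).L ≤ ν.M₁ → side (F.P Kt).L ν.M₁ k ∣ (F.P Kt).sitesPerDir 0 → 0 ≤ ν.εreg →
      6 * ((((F.P Kt).d - 1 : ℕ)) : ℝ) * (F.P Kt).L * ν.εreg ≤ ρ'' →
      ∀ (ext : GaugeField (F.P Kt) k SU2 → GaugeField (F.P Kt) k SU2) (Vk : GaugeField (F.P Kt) k SU2),
      ∀ (U₀ : GaugeField (F.P Kt) 0 SU2) (Xf : GaugeSlice (pts k Λ) T E3 → PBond (F.P Kt) 0 → lieSU (Fin 2)),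
      IsMinimizer (Node00.avOfRecord F 2 Kt) (Node00.regMSCoPOfRecord F 2 ν Kt k (maxDomT ν.M₁ Z)) (Bj ν.M₁ Z k)
        (avgFamily (Node00.avOfRecord F 2 Kt) (qsstarGIter0 k (ext Vk))) U₀ →
      ∀ ⦃εP : ℝ⦄, 0 ≤ εP →
      (∀ p : Plaq (F.P Kt) 0, ((⟨p.src, p.μ⟩ : PBond (F.P Kt) 0) ∈ {b : PBond (F.P Kt) 0 | b.src ∈ maxDomT ν.M₁ Z 1} ∨
          (⟨p.src.shift p.μ, p.ν⟩ : PBond (F.P Kt) 0) ∈ {b : PBond (F.P Kt) 0 | b.src ∈ maxDomT ν.M₁ Z 1} ∨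
          (⟨p.src.shift p.ν, p.μ⟩ : PBond (F.P Kt) 0) ∈ {b : PBond (F.P Kt) 0 | b.src ∈ maxDomT ν.M₁ Z 1} ∨
          (⟨p.src, p.ν⟩ : PBond (F.P Kt) 0) ∈ {b : PBond (F.P Kt) 0 | b.src ∈ maxDomT ν.M₁ Z 1}) →
        ‖((GaugeField.plaqHol U₀ p : SU2) : Matrix (Fin 2) (Fin 2) ℂ) - 1‖ ≤ εP) →
      ∀ (H : (Fin (constrCard (Bj ν.M₁ Z k) k) → lieSU (Fin 2)) → PBond (F.P Kt) 0 → lieSU (Fin 2)),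
      (∀ v, fderiv ℝ (msChart F 2 Kt k (Bj ν.M₁ Z k) (avgFamily (avOfRecord F 2 Kt) (qsstarGIter0 k (ext Vk))) U₀) 0 (H v) = v) →
      ∀ ⦃B₁ : ℝ⦄, 0 ≤ B₁ →
      (∀ i : Fin (constrCard (Bj ν.M₁ Z k) k), 1 ≤ ((((constrEnum (Bj ν.M₁ Z k) k).symm i).1 : ℕ)) → ∀ ξ : lieSU (Fin 2),
        ∃ x : PBond (F.P Kt) 0 → lieSU (Fin 2), fderiv ℝ (msChart F 2 Kt k (Bj ν.M₁ Z k) (avgFamily (avOfRecord F 2 Kt) (qsstarGIter0 k (ext Vk))) U₀) 0 x = Pi.single i ξ ∧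
          ∑ b, ‖(x b : Matrix (Fin 2) (Fin 2) ℂ)‖ ≤ B₁ * ‖ξ‖) →
      ∀ ⦃M₂ : ℝ⦄, (∀ w, ∑ c, ‖fderiv ℝ (fderiv ℝ (msChart F 2 Kt k (Bj ν.M₁ Z k) (avgFamily (avOfRecord F 2 Kt) (qsstarGIter0 k (ext Vk))) U₀)) 0 w w c‖ ≤ M₂ * ∑ b, ‖w b‖ ^ 2) →
      Xf 0 = 0 → ContDiffAt ℝ 2 Xf 0 →
      (∀ᶠ Y in 𝓝 (0 : GaugeSlice (pts k Λ) T E3),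
        IsMinimizer (Node00.avOfRecord F 2 Kt) (Node00.regMSCoPOfRecord F 2 ν Kt k (maxDomT ν.M₁ Z)) (Bj ν.M₁ Z k)
          (avgFamily (Node00.avOfRecord F 2 Kt) (qsstarGIter0 k (expMul su2Chart (ιA (pts k Λ) T Y) (ext Vk)))) (expChart U₀ (Xf Y))) →
      ∀ ⦃K₂ : ℝ⦄, (∀ X : GaugeSlice (pts k Λ) T E3, Real.sqrt (∑ b, ‖fderiv ℝ Xf 0 X b‖ ^ 2) ≤ K₂ * ‖X‖) →
      ∀ (W : Finset (Plaq (F.P Kt) 0)),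
      (∀ q : Plaq (F.P Kt) 0, q.src ∈ ((box (fun κ => (F.P Kt).L ^ k * ((hi κ - lo κ + 1).toNat + 3 + 1) - 1) (fun κ => ((F.P Kt).L : ℤ) ^ k * (lo κ - 2))).image
          (fun z => (castSite z : Site (F.P Kt) 0))) → q ∈ W) →
      ∀ ⦃δW : ℝ⦄, 0 < δW → δW < ρ → δW < ρτ →
      (∀ (ν' : Fin (F.P Kt).d), ∀ z ∈ box (fun κ => (hi κ - lo κ + 1).toNat + 3) (fun κ => lo κ - 2), ∀ b₀ : PBond (F.P Kt) 0,
        (b₀ ∈ feeds k (⟨(castSite z : Site (F.P Kt) k), ⟨0, h0⟩⟩ : PBond (F.P Kt) k) ∨ b₀ ∈ feeds k (⟨((castSite z : Site (F.P Kt) k)).shift ⟨0, h0⟩, ν'⟩ : PBond (F.P Kt) k)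
        ∨ b₀ ∈ feeds k (⟨((castSite z : Site (F.P Kt) k)).shift ν', ⟨0, h0⟩⟩ : PBond (F.P Kt) k) ∨ b₀ ∈ feeds k (⟨(castSite z : Site (F.P Kt) k), ν'⟩ : PBond (F.P Kt) k)) →
        ‖((U₀ b₀ : SU2) : Matrix (Fin 2) (Fin 2) ℂ) - 1‖ ≤ δW) →
      ∃ (Ψ₂ : (PBond (F.P Kt) 0 → lieSU (Fin 2)) →L[ℝ] (PBond (F.P Kt) 0 → lieSU (Fin 2)) →L[ℝ] (Fin (constrCard (Bj ν.M₁ Z k) k) → lieSU (Fin 2)))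
        (lam : (Fin (constrCard (Bj ν.M₁ Z k) k) → lieSU (Fin 2)) →L[ℝ] ℝ)
        (p : Seminorm ℝ (PBond (F.P Kt) 0 → lieSU (Fin 2))),
        HasFDerivAt (fun Y => fderiv ℝ (msChart F 2 Kt k (Bj ν.M₁ Z k) (avgFamily (avOfRecord F 2 Kt) (qsstarGIter0 k (ext Vk))) U₀) Y) Ψ₂ 0 ∧
        (∀ᶠ Y in 𝓝 (0 : PBond (F.P Kt) 0 → lieSU (Fin 2)), DifferentiableAt ℝ (msChart F 2 Kt k (Bj ν.M₁ Z k) (avgFamily (avOfRecord F 2 Kt) (qsstarGIter0 k (ext Vk))) U₀) Y) ∧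
        fderiv ℝ (fun Y : PBond (F.P Kt) 0 → lieSU (Fin 2) => wilsonAction4 (expChart U₀ Y)) 0 = lam.comp (fderiv ℝ (msChart F 2 Kt k (Bj ν.M₁ Z k) (avgFamily (avOfRecord F 2 Kt) (qsstarGIter0 k (ext Vk))) U₀) 0) ∧
        (∀ Y : PBond (F.P Kt) 0 → lieSU (Fin 2), ∑ b, ‖(Y b : Matrix (Fin 2) (Fin 2) ℂ)‖ ^ 2 ≤ p Y ^ 2) ∧
        ∀ X : GaugeSlice (pts k Λ) T E3,
          lam (Ψ₂ (fderiv ℝ Xf 0 X) (fderiv ℝ Xf 0 X))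
              ≤ (2 * (((F.P Kt).d : ℝ) - 1) * εP * B₁ * M₂) * p (fderiv ℝ Xf 0 X) ^ 2 ∧
          p (fderiv ℝ Xf 0 X) ≤ K₂ * ‖X‖ ∧
          (((F.P Kt).L : ℝ) ^ (F.P Kt).d) ^ k / ((((F.P Kt).L : ℝ)) ^ 2 * ((F.P Kt).L : ℝ) ^ 2) ^ k / 2 * (∑ z ∈ box (fun κ => (hi κ - lo κ + 1).toNat + 3) (fun κ => lo κ - 2), ∑ μ : Fin (F.P Kt).d, ∑ a : Fin 3, curl (fun b => ιA (pts k Λ) T X (⟨castSite b.1, b.2⟩ : PBond (F.P Kt) k) a) z ⟨0, h0⟩ μ ^ 2)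
              - (((F.P Kt).L : ℝ) ^ (F.P Kt).d) ^ k / ((((F.P Kt).L : ℝ)) ^ 2 * ((F.P Kt).L : ℝ) ^ 2) ^ k * (8 * (((F.P Kt).d : ℝ) + 1) * (2 * (Kτ + 1) * δW) + 8 * ((F.P Kt).d : ℝ) * (((box (fun κ => (hi κ - lo κ + 1).toNat + 3) (fun κ => lo κ - 2)).image (fun z => (castSite z : Site (F.P Kt) k))).card : ℝ) * (C * δW * K₂) ^ 2) * ‖X‖ ^ 2
            ≤ ((Fintype.card (Fin 2) : ℝ)⁻¹ • ∑ p ∈ W, (innerSL ℝ (E := lieSU (Fin 2))).bilinearComp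
              (ContinuousLinearMap.proj (R := ℝ) (φ := fun _ : PBond (F.P Kt) 0 => lieSU (Fin 2)) (⟨p.src, p.μ⟩ : PBond (F.P Kt) 0) + ContinuousLinearMap.proj (R := ℝ) (φ := fun _ : PBond (F.P Kt) 0 => lieSU (Fin 2)) (⟨p.src.shift p.μ, p.ν⟩ : PBond (F.P Kt) 0)
                - ContinuousLinearMap.proj (R := ℝ) (φ := fun _ : PBond (F.P Kt) 0 => lieSU (Fin 2)) (⟨p.src.shift p.ν, p.μ⟩ : PBond (F.P Kt) 0) - ContinuousLinearMap.proj (R := ℝ) (φ := fun _ : PBond (F.P Kt) 0 => lieSU (Fin 2)) (⟨p.src, p.ν⟩ : PBond (F.P Kt) 0) : (PBond (F.P Kt) 0 → lieSU (Fin 2)) →L[ℝ] lieSU (Fin 2))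
              (ContinuousLinearMap.proj (R := ℝ) (φ := fun _ : PBond (F.P Kt) 0 => lieSU (Fin 2)) (⟨p.src, p.μ⟩ : PBond (F.P Kt) 0) + ContinuousLinearMap.proj (R := ℝ) (φ := fun _ : PBond (F.P Kt) 0 => lieSU (Fin 2)) (⟨p.src.shift p.μ, p.ν⟩ : PBond (F.P Kt) 0)
                - ContinuousLinearMap.proj (R := ℝ) (φ := fun _ : PBond (F.P Kt) 0 => lieSU (Fin 2)) (⟨p.src.shift p.ν, p.μ⟩ : PBond (F.P Kt) 0) - ContinuousLinearMap.proj (R := ℝ) (φ := fun _ : PBond (F.P Kt) 0 => lieSU (Fin 2)) (⟨p.src, p.ν⟩ : PBond (F.P Kt) 0) : (PBond (F.P Kt) 0 → lieSU (Fin 2)) →L[ℝ] lieSU (Fin 2))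
              : (PBond (F.P Kt) 0 → lieSU (Fin 2)) →L[ℝ] (PBond (F.P Kt) 0 → lieSU (Fin 2)) →L[ℝ] ℝ) (fderiv ℝ Xf 0 X) (fderiv ℝ Xf 0 X) := by
  classical
  -- ### the `linAvg` iterate and the explicit junction seminorm (for the velocity-form clause's constants)
  let Q : (i : ℕ) → (PBond (F.P Kt) 0 → Matrix (Fin 2) (Fin 2) ℂ) → PBond (F.P Kt) i → Matrix (Fin 2) (Fin 2) ℂ := fun i =>
    Nat.rec (motive := fun i => (PBond (F.P Kt) 0 → Matrix (Fin 2) (Fin 2) ℂ) → PBond (F.P Kt) i → Matrix (Fin 2) (Fin 2) ℂ)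
      (fun Y => Y) (fun _ q Y c => linAvg (q Y) c) i
  have hQ0 : ∀ Y, Q 0 Y = Y := fun Y => rfl
  have hQs : ∀ (i : ℕ) (Y : PBond (F.P Kt) 0 → Matrix (Fin 2) (Fin 2) ℂ) (c : PBond (F.P Kt) (i + 1)), Q (i + 1) Y c = linAvg (Q i Y) c :=
    fun i Y c => rfl
  let p₀ : Seminorm ℝ (PBond (F.P Kt) 0 → lieSU (Fin 2)) :=
    (normSeminorm ℝ (PiLp 2 (fun _ : PBond (F.P Kt) 0 => lieSU (Fin 2)))).comp (WithLp.linearEquiv 2 ℝ (PBond (F.P Kt) 0 → lieSU (Fin 2))).symm.toLinearMap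
  have hp₀ : ∀ Y : PBond (F.P Kt) 0 → lieSU (Fin 2), ∑ b, ‖(Y b : Matrix (Fin 2) (Fin 2) ℂ)‖ ^ 2 ≤ p₀ Y ^ 2 := fun Y => sum_opNorm_sq_le_l2Seminorm_sq Y
  -- ### the per-height constants
  obtain ⟨C, ρ, hC, hρ, hδ2⟩ := exists_delta2_letter_component (F := F) (N := 2) (K := Kt) k Q hQ0 hQs p₀ hp₀
  obtain ⟨Kτ, ρτ, hKτ, hρτ, htw⟩ := exists_twistSize_of_nearFlat_feeds (F := F) (N := 2) Kt k
  obtain ⟨_, ρ'', _, hρ'', hsbU, _⟩ := exists_uniform_chartCurvature_sq_bound (F := F) (N := 2) (K := Kt) k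
  refine ⟨C, ρ, Kτ, ρτ, ρ'', hC, hρ, hKτ, hρτ, hρ'', ?_⟩
  intro ν Z Λ T lo hi hbox hΩw hkK hM4 hdiv hε hερ ext Vk U₀ Xf hmin0 εP hεP0 hP H hHinv B₁ hB1 hrow M₂ hM₂1 hX₀ hXc hmin K₂ hK2 W hWin δW hδW0 hδWρ hδWτ hδW
  -- ### the chart rows (P1)
  obtain ⟨Ψ₂, lam, p, hΨ₂, hΨd, hlam, hp, hrows⟩ :=
    chartRows_direct_of_class_rowl1 ν Kt hk0 Z Λ T ext Vk U₀ Xf hmin0 hkK hM4 hdiv hε hsbU hερ hεP0 hP H hHinv hB1 hrow hM₂1 hK2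
  refine ⟨Ψ₂, lam, p, hΨ₂, hΨd, hlam, hp, fun X => ⟨(hrows X).1, (hrows X).2, ?_⟩⟩
  -- ### the velocity-form Federbush clause: region letters discharged by the block tower of the box (as p646479 §1)
  have hUfib : AgreeOn (Bj ν.M₁ Z k) (avgFamily (avOfRecord F 2 Kt) U₀) (avgFamily (avOfRecord F 2 Kt) (qsstarGIter0 k (ext Vk))) := hmin0.2.1
  let Sset : (i : ℕ) → Finset (Site (F.P Kt) i) := fun i =>
    (box (fun κ => (F.P Kt).L ^ (k - i) * (((hi κ - lo κ + 1).toNat + 3) + 1) - 1) (fun κ => ((F.P Kt).L : ℤ) ^ (k - i) * (lo κ - 2))).image (fun z => (castSite z : Site (F.P Kt) i))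
  have hSk : Sset k = (box (fun κ => (hi κ - lo κ + 1).toNat + 3) (fun κ => lo κ - 2)).image (fun z => (castSite z : Site (F.P Kt) k)) := by
    simp only [Sset, Nat.sub_self, pow_zero, one_mul, Nat.add_sub_cancel]
  have hwin : ∀ z ∈ box (fun κ => (hi κ - lo κ + 1).toNat + 3) (fun κ => lo κ - 2), (castSite z : Site (F.P Kt) k) ∈ Sset k := fun z hz => by
    rw [hSk]
    exact Finset.mem_image_of_mem _ hz
  have hS : ∀ (ν' : Fin (F.P Kt).d), (⟨0, h0⟩ : Fin (F.P Kt).d) ≠ ν' → ∀ i, i < k → ∀ y ∈ Sset (i + 1), ∀ (r : Fin (F.P Kt).d → Fin (F.P Kt).L) (s t : ℕ),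
      s < (F.P Kt).L → t < (F.P Kt).L → runSite (runSite (Site.blockSite y r) ⟨0, h0⟩ s) ν' t ∈ Sset i := by
    intro ν' hν i hi y hy r s t hs ht
    exact runSite_runSite_blockSite_mem_tower h0 (lt_of_lt_of_le hi hk) hν hi hy r hs ht
  have hΩk : ∀ (ν' : Fin (F.P Kt).d), ∀ s ∈ Sset k, s ∈ pts k (maxDomT ν.M₁ Z k) ∧ s.shift ⟨0, h0⟩ ∈ pts k (maxDomT ν.M₁ Z k) ∧ s.shift ν' ∈ pts k (maxDomT ν.M₁ Z k) := by
    intro ν' s hs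
    rw [hSk, Finset.mem_image] at hs
    obtain ⟨z, hz, rfl⟩ := hs
    exact hΩw ν' z hz
  have hW0 : ∀ q : Plaq (F.P Kt) 0, q.src ∈ Sset 0 → q ∈ W := fun q hq => hWin q (by simpa only [Sset, Nat.sub_zero] using hq)
  have hcons := hcons_of_plaqsInside_maxDomT h0 Z (Sset k) hΩk
  -- near-flatness on the feeds of the region's plaquette bonds, re-indexed through `S_k = castSite″ box`
  have hδW' : ∀ (ν' : Fin (F.P Kt).d), ∀ s ∈ Sset k, ∀ b₀ : PBond (F.P Kt) 0,
      (b₀ ∈ feeds k (⟨s, ⟨0, h0⟩⟩ : PBond (F.P Kt) k) ∨ b₀ ∈ feeds k (⟨(s).shift ⟨0, h0⟩, ν'⟩ : PBond (F.P Kt) k)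
        ∨ b₀ ∈ feeds k (⟨(s).shift ν', ⟨0, h0⟩⟩ : PBond (F.P Kt) k) ∨ b₀ ∈ feeds k (⟨s, ν'⟩ : PBond (F.P Kt) k)) →
      ‖((U₀ b₀ : SU 2) : Matrix (Fin 2) (Fin 2) ℂ) - 1‖ ≤ δW := by
    intro ν' s hs b₀ hb₀
    rw [hSk, Finset.mem_image] at hs
    obtain ⟨z, hz, rfl⟩ := hs
    exact hδW ν' z hz b₀ hb₀
  -- the twist size at the region's plaquette bonds from the tower near-flatness
  have htwb : ∀ (c : PBond (F.P Kt) k), c ∈ bondsOf (Bj ν.M₁ Z k k) →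
      (∀ b₀ ∈ feeds k c, ‖((U₀ b₀ : SU 2) : Matrix (Fin 2) (Fin 2) ℂ) - 1‖ ≤ δW) →
      ‖((avgFamily (avOfRecord F 2 Kt) (qsstarGIter0 k (ext Vk)) k c : SU 2) : Matrix (Fin 2) (Fin 2) ℂ) - 1‖ ≤ (2 * (Kτ + 1) * δW) / 2 := by
    intro c hc hloc
    have h := htw (Bj ν.M₁ Z k) (avgFamily (avOfRecord F 2 Kt) (qsstarGIter0 k (ext Vk))) U₀ hk hUfib c hc hδW0.le hδWτ hloc
    have h2 : Kτ * δW ≤ (2 * (Kτ + 1) * δW) / 2 := by nlinarith [hδW0.le]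
    exact h.trans h2
  have hW' : ∀ (ν' : Fin (F.P Kt).d), ∀ s ∈ Sset k,
      ‖((avgFamily (avOfRecord F 2 Kt) (qsstarGIter0 k (ext Vk)) k ⟨s, ⟨0, h0⟩⟩ : SU 2) : Matrix (Fin 2) (Fin 2) ℂ) - 1‖ ≤ (2 * (Kτ + 1) * δW) / 2 ∧
      ‖((avgFamily (avOfRecord F 2 Kt) (qsstarGIter0 k (ext Vk)) k ⟨s.shift ⟨0, h0⟩, ν'⟩ : SU 2) : Matrix (Fin 2) (Fin 2) ℂ) - 1‖ ≤ (2 * (Kτ + 1) * δW) / 2 ∧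
      ‖((avgFamily (avOfRecord F 2 Kt) (qsstarGIter0 k (ext Vk)) k ⟨s.shift ν', ⟨0, h0⟩⟩ : SU 2) : Matrix (Fin 2) (Fin 2) ℂ) - 1‖ ≤ (2 * (Kτ + 1) * δW) / 2 ∧
      ‖((avgFamily (avOfRecord F 2 Kt) (qsstarGIter0 k (ext Vk)) k ⟨s, ν'⟩ : SU 2) : Matrix (Fin 2) (Fin 2) ℂ) - 1‖ ≤ (2 * (Kτ + 1) * δW) / 2 := by
    intro ν' s hs
    obtain ⟨h1, h2, h3, h4⟩ := hcons ν' s hs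
    exact ⟨htwb _ h1 fun b₀ hb₀ => hδW' ν' s hs b₀ (Or.inl hb₀), htwb _ h2 fun b₀ hb₀ => hδW' ν' s hs b₀ (Or.inr (Or.inl hb₀)),
      htwb _ h3 fun b₀ hb₀ => hδW' ν' s hs b₀ (Or.inr (Or.inr (Or.inl hb₀))), htwb _ h4 fun b₀ hb₀ => hδW' ν' s hs b₀ (Or.inr (Or.inr (Or.inr hb₀)))⟩
  have hτ : 0 < (2 * (Kτ + 1) * δW) := by positivity
  have hΨ : DifferentiableAt ℝ (msChart F 2 Kt k (Bj ν.M₁ Z k) (avgFamily (avOfRecord F 2 Kt) (qsstarGIter0 k (ext Vk))) U₀) 0 :=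
    (chartLetters_msChart_Bj_of_isMinimizer_of_class ν Kt Z hkK hM4 hdiv hε hsbU hερ hmin0).2.1.hasFDerivAt.differentiableAt
  have hX1 : HasFDerivAt Xf (fderiv ℝ Xf 0) 0 := (hXc.differentiableAt two_ne_zero).hasFDerivAt
  have hη0 : (0 : ℝ) < 1 / 2 := by norm_num
  have hη1 : (1 : ℝ) / 2 < 1 := by norm_num
  -- (K) for the explicit seminorm `p₀`
  have hK0 : ∀ X' : GaugeSlice (pts k Λ) T E3, p₀ (fderiv ℝ Xf 0 X') ≤ K₂ * ‖X'‖ := by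
    intro X'
    rw [show p₀ (fderiv ℝ Xf 0 X') = Real.sqrt (∑ b, ‖fderiv ℝ Xf 0 X' b‖ ^ 2) from l2Seminorm_apply _]
    exact hK2 X'
  -- the velocity-form clause at `η = 1∕2` (Pauli coordinates eliminated in term mode)
  have key := exists_lieSU2Coord.elim fun φ hφ =>
    hmX_federbush_window_of_delta2Component h0 hk Q hQ0 hQs p₀ hδ2 Z X (fun κ => lo κ - 2) hbox Sset hwin hS hφ hΩk (regMSCoPOfRecord F 2 ν Kt k (maxDomT ν.M₁ Z)) (ext Vk) U₀ hX₀ hmin hX1 hΨ hτ hW' W hW0 hδW0.le hδWρ hδW' hη0 hη1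
  -- arithmetic: `(C·δ_W·p₀(X_f′X))² ≤ (C·δ_W·Kc)²‖X‖²`, `|S_k|` of the statement = `(S_k).card`
  have hcard : ((Sset k).card : ℝ) = (((box (fun κ => (hi κ - lo κ + 1).toNat + 3) (fun κ => lo κ - 2)).image (fun z => (castSite z : Site (F.P Kt) k))).card : ℝ) := by rw [hSk]
  have hpK : (C * δW * p₀ (fderiv ℝ Xf 0 X)) ^ 2 ≤ (C * δW * K₂) ^ 2 * ‖X‖ ^ 2 := by
    have h1 : 0 ≤ C * δW * p₀ (fderiv ℝ Xf 0 X) := by positivity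
    have h2 : C * δW * p₀ (fderiv ℝ Xf 0 X) ≤ C * δW * (K₂ * ‖X‖) := mul_le_mul_of_nonneg_left (hK0 X) (by positivity)
    calc (C * δW * p₀ (fderiv ℝ Xf 0 X)) ^ 2 ≤ (C * δW * (K₂ * ‖X‖)) ^ 2 := pow_le_pow_left₀ h1 h2 2
      _ = (C * δW * K₂) ^ 2 * ‖X‖ ^ 2 := by ring
  have hratio : 0 ≤ (((F.P Kt).L : ℝ) ^ (F.P Kt).d) ^ k / ((((F.P Kt).L : ℝ)) ^ 2 * ((F.P Kt).L : ℝ) ^ 2) ^ k := by positivity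
  have hinv : ((1 : ℝ) / 2)⁻¹ - 1 = 1 := by norm_num
  have hhalf : (1 : ℝ) - 1 / 2 = 1 / 2 := by norm_num
  rw [hinv, hhalf, one_mul, hcard] at key
  have h3 : (((F.P Kt).L : ℝ) ^ (F.P Kt).d) ^ k / ((((F.P Kt).L : ℝ)) ^ 2 * ((F.P Kt).L : ℝ) ^ 2) ^ k * (8 * ((F.P Kt).d : ℝ) * (((box (fun κ => (hi κ - lo κ + 1).toNat + 3) (fun κ => lo κ - 2)).image (fun z => (castSite z : Site (F.P Kt) k))).card : ℝ) * (C * δW * p₀ (fderiv ℝ Xf 0 X)) ^ 2)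
      ≤ (((F.P Kt).L : ℝ) ^ (F.P Kt).d) ^ k / ((((F.P Kt).L : ℝ)) ^ 2 * ((F.P Kt).L : ℝ) ^ 2) ^ k * (8 * ((F.P Kt).d : ℝ) * (((box (fun κ => (hi κ - lo κ + 1).toNat + 3) (fun κ => lo κ - 2)).image (fun z => (castSite z : Site (F.P Kt) k))).card : ℝ) * ((C * δW * K₂) ^ 2 * ‖X‖ ^ 2)) :=
    mul_le_mul_of_nonneg_left (mul_le_mul_of_nonneg_left hpK (by positivity)) hratio
  refine le_trans ?_ key
  linarith [h3]

end Package

end Summit.QuantumFields.YangMills.BalabanUVNodes.N12DirectChartPackageOfClassRowL1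

end
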